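import Literature.NumberTheory.Automorphic.HilbertRepSpectrum
import Mathlib.Topology.Algebra.Module.FiniteDimension
import HarnessLib

/-!
# A finite-dimensional topologically irreducible closed subrepresentation has no stable subspaces except `0` and itself

Topic `NumberTheory/Automorphic`; namespace `Literature.NumberTheory.Automorphic`; theorems only (no definition, no named fact, no instance, no `sorry`).  Cell
`hodgecm-mathlib`, line T1a, road HC to the trace-class letter A5, GLUE G3 of the assembly contract (lead F0P3b-p01 (g2)): the irreducible orthogonal `K`-decomposition
`S` of ★ `exists_irreducible_orthogonal_blocks` (`CompactGroupBlockNuclearTraceClass`) consists of CLOSED subrepresentations `W` with `W.toContRep.IsTopIrreducible`, while the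
Casimir block bound ★ `norm_apply_le_of_kBlock` (`UnitaryRepKCasimirBlockBound`, A-p14) takes a SUBMODULE `W ≤ E` with the algebraic irreducibility clause «every
`K`-stable `W' ≤ W` is `⊥` or `W`».  This file translates the former into the latter.

* `ClosedSubrep.eq_bot_or_eq_of_le_of_isTopIrreducible` — for `W` finite-dimensional with `W.toContRep` topologically irreducible and a `σ`-stable submodule `W' ≤ W`:
  `W' = ⊥ ∨ W' = W`.

## References
* J. Dixmier, *C\*-algebras* (1977), §13.1.2 (sub-representations) [Dixmier1977].
* A. Deitmar, S. Echterhoff, *Principles of Harmonic Analysis*, 2nd ed. (2014), Lemma 6.1.7 [DeitmarEchterhoff2014].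
-/

set_option autoImplicit false

noncomputable section

namespace Literature.NumberTheory.Automorphic

variable {K : Type*} [Group K] {E : Type*} [NormedAddCommGroup E] [InnerProductSpace ℂ E]
  {σ : ContRepresentation ℂ K E}

/-- **A finite-dimensional topologically irreducible block has only the trivial stable subspaces**: if `W` is a finite-dimensional closed subrepresentation of `σ` with
`W.toContRep` topologically irreducible, then every `σ`-stable submodule `W' ≤ W` is `⊥` or `W` (pull `W'` back to a closed — finite-dimensional — subrepresentation of
`W.toContRep` and use ★ `isTopIrreducible_iff`). [cite: DeitmarEchterhoff2014, Lemma 6.1.7] [cite: Dixmier1977, §13.1.2] -/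
theorem ClosedSubrep.eq_bot_or_eq_of_le_of_isTopIrreducible (W : ContRepresentation.ClosedSubrep σ) [FiniteDimensional ℂ W.toSubmodule]
    (hirr : W.toContRep.IsTopIrreducible) (W' : Submodule ℂ E) (hle : W' ≤ W.toSubmodule)
    (hst : ∀ (k : K) (v : E), v ∈ W' → σ k v ∈ W') :
    W' = ⊥ ∨ W' = W.toSubmodule := by
  obtain ⟨-, hall⟩ := (ContRepresentation.isTopIrreducible_iff W.toContRep).mp hirr
  -- `W'` pulled back to `↥W`
  set V' : Submodule ℂ W.toSubmodule := W'.comap W.toSubmodule.subtype with hV'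
  have hV'st : ∀ (k : K) (v : W.toSubmodule), v ∈ V' → W.toContRep k v ∈ V' := by
    intro k v hv
    change ((W.toContRep k v : W.toSubmodule) : E) ∈ W'
    rw [ContRepresentation.ClosedSubrep.coe_toContRep_apply]
    exact hst k v hv
  let C : ContRepresentation.ClosedSubrep W.toContRep :=
    ⟨⟨V', fun k v hv => hV'st k v hv⟩, (V'.closed_of_finiteDimensional)⟩
  have hCmem : ∀ v : W.toSubmodule, v ∈ C ↔ (v : E) ∈ W' := fun v => Iff.rfl
  rcases hall C with h | h
  · left
    rw [Submodule.eq_bot_iff]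
    intro v hv
    have hvW : v ∈ W.toSubmodule := hle hv
    have hC : (⟨v, hvW⟩ : W.toSubmodule) ∈ C := (hCmem ⟨v, hvW⟩).2 hv
    rw [h] at hC
    have h0 : (⟨v, hvW⟩ : W.toSubmodule) = 0 := (ContRepresentation.ClosedSubrep.mem_bot).1 hC
    exact congrArg Subtype.val h0
  · right
    refine le_antisymm hle fun v hvW => ?_
    have hC : (⟨v, hvW⟩ : W.toSubmodule) ∈ C := by rw [h]; exact ContRepresentation.ClosedSubrep.mem_top _
    exact (hCmem ⟨v, hvW⟩).1 hC

end Literature.NumberTheory.Automorphic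

end
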